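import Summits.BirchSwinnertonDyer.BirchSwinnertonDyer.Theorems.ThetaPartnerAtTwoSignedKatoUpToAtTwoCuspFactorGeneration
import Summits.BirchSwinnertonDyer.BirchSwinnertonDyer.Theorems.ThetaPartnerAtTwoSignedKatoUpToAtTwoCuspFactorOddTwistSupply
import HarnessLib

/-!
# Route `ThetaPartnerAtTwo` (TP2), crux K3 `SignedKatoDivisibilityUpToAtTwo` (stmt-BirchSwinnertonDyer-20308 / K3P′ 25631), line
# `colemanrat` v12 — CUSP-FACTOR GENERATION IN MODULAR-SYMBOL CURRENCY: for every height-one `𝔭 ∌ 2` some admissible `(c, d)` and cusp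
# `a/2^e` put Kato's four-term MINUS-symbol cusp element outside `𝔭` (conditional on Rohrlich's theorem)

Width seat `bsd-wall-tp2-p2x-w2` g6 (cell `bsd-wall`). HONEST FRAMING: theorems only (no definition, no named fact, no instance, no
`sorry`); CONDITIONAL on the tree's named fact `Rohrlich1984_nonvanishing_twists`; closes no item; K3 / K3P′ are NOT settled and BSD is NOT
proved by any of this.

## What (memo `Cruxes/SignedKatoDivisibilityUpToAtTwo/W2G6-KATO1312-AT2.md` §1–§2)

`exists_cuspElement_not_mem_of_rohrlich`: for a rational newform `f` of odd level (the habitat: good reduction at `2`), avoidance moduli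
`Qc` (prime to `10`; Kato: `3`) and `Qd` (odd; Kato: `3N`), an exponent twist `η ∈ ℤ₂`, a height-one prime `𝔭` of `Λ = ℤ₂⟦T⟧` with `2 ∉ 𝔭`,
and any `e₀`: there are a level `2^e` (`e ≥ e₀`, `e ≥ 3`), a cusp class `a ∈ (ℤ/2^e)^×`, a scaling `D ≥ 1` with `t(b) = D·[ab/2^e]⁻_f ∈ ℤ`,
and admissible `c, d` (prime to `2Qc`, `2Qd`; units `u_c, u_d`; classes `c̄, d̄`) such that
`C(c²d²t(1)) − C(cd²t(c̄))·(1+T)^{ηℓ(u_c)} − C(c²d t(d̄⁻¹))·(1+T)^{ηℓ(u_d)} + C(cd t(c̄d̄⁻¹))·(1+T)^{ηℓ(u_c)}(1+T)^{ηℓ(u_d)} ∉ 𝔭` — the element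
`D·μ̃(c,d,a,2^e)` of the K3 assembly (`Kato2004.EulerSystemValues.cuspFactor f true …` with `A = 2^e`, `[x]⁻ = ratMinusSymbol f x`, and
`χ̄(c) ↦ (1+T)^{ηℓ(c)}`). Assembled from `OddTwistSupply.exists_three_unitHom_sum_ratMinusSymbol_ne_zero` (Rohrlich + odd Birch) and
`CuspEval.exists_cuspElement_not_mem` (generation), after translating the cusp by a class `a` with `[a/2^e]⁻ ≠ 0` and clearing denominators.

References: [Kato2004Asterisque] K. Kato, Astérisque 295 (2004), Thm. 12.6 (p. 222), §13.12 (pp. 231–233), Thm. 13.5 (2) (p. 227);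
[RohrlichInventiones1984] Theorem p. 409; [MazurTateTeitelbaum1986Invent] §I.8 (8.6).
-/

set_option autoImplicit false
-- the Theorems namespace of this sub repeats the summit name by design (D-0017 nested layout)
set_option linter.dupNamespace false

noncomputable section

open scoped BigOperators

open Literature.NumberTheory.EllipticCurves Literature.NumberTheory.EllipticCurves.ModularForms
  Literature.NumberTheory.EllipticCurves.CyclotomicZp

namespace Summit.BirchSwinnertonDyer.BirchSwinnertonDyer.Theorems.SignedKatoOffTwo.CuspEval

/-- **Clearing denominators** of a `ℚ`-valued function on a finite type: `t = D·s` is `ℤ`-valued for some `D ≥ 1`. [folklore] -/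
theorem exists_int_eq_mul {G : Type*} [Fintype G] (s : G → ℚ) :
    ∃ (D : ℕ) (t : G → ℤ), 0 < D ∧ ∀ b, (t b : ℚ) = D * s b := by
  classical
  refine ⟨∏ b, (s b).den, fun b ↦ ((∏ b' ∈ Finset.univ.erase b, (s b').den : ℕ) : ℤ) * (s b).num,
    Finset.prod_pos fun b _ ↦ (s b).den_pos, fun b ↦ ?_⟩
  rw [← Finset.mul_prod_erase Finset.univ (fun b' ↦ (s b').den) (Finset.mem_univ b)]
  push_cast
  rw [mul_comm ((s b).den : ℚ), mul_assoc, Rat.den_mul_eq_num]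

/-- **CUSP-FACTOR GENERATION, modular-symbol currency (conditional on Rohrlich).** See the module docstring. For a normalised newform
`f ∈ S₂(Γ₀(N))` with rational coefficients and `2 ∤ N`, granting `Rohrlich1984_nonvanishing_twists`: for every height-one prime `𝔭` of
`Λ = ℤ₂⟦T⟧` with `2 ∉ 𝔭`, every `η ∈ ℤ₂`, avoidance moduli `Qc` (prime to `10`), `Qd` (odd), and every `e₀`, there are `e ≥ max(e₀, 3)`, a cusp
class `a`, a scaling `D ≥ 1` with `t(b) = D·[ab/2^e]⁻_f ∈ ℤ`, and admissible `c, d` such that the four-term cusp element with coefficients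
`c²d²t(1)`, `cd²t(c̄)`, `c²d t(d̄⁻¹)`, `cd t(c̄d̄⁻¹)` and avatars `(1+T)^{ηℓ(u_c)}`, `(1+T)^{ηℓ(u_d)}` lies OUTSIDE `𝔭`. This is Kato's §13.12
choice («a power `A` of `p` and `ν` of conductor `A`», Thm. 13.5 (2)) at `p = 2` over `ℤ₂⟦T⟧` with one cusp instead of an auxiliary character.
CONDITIONAL on `hR`; closes nothing. [cite: Kato2004Asterisque, Thm. 12.6 (p. 222), §13.12 (pp. 231–233), Thm. 13.5 (2) (p. 227)]
[cite: RohrlichInventiones1984, Theorem (p. 409)] -/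
theorem exists_cuspElement_not_mem_of_rohrlich (hR : Rohrlich1984_nonvanishing_twists)
    {N : ℕ} [NeZero N] {f : CuspForm (CongruenceSubgroup.Gamma0 N) 2} (hf : IsNewform0 f) (hQf : coeffField f = ⊥) (h2N : ¬ 2 ∣ N)
    {Qc Qd : ℕ} (hQc2 : Nat.Coprime 2 Qc) (hQc5 : Nat.Coprime 5 Qc) (hQd : Nat.Coprime 2 Qd) (η : ℤ_[2])
    (𝔭 : PrimeSpectrum (IwasawaAlgebra 2)) (h𝔭 : 𝔭.asIdeal.height = 1) (h2 : PowerSeries.C (2 : ℤ_[2]) ∉ 𝔭.asIdeal) (e₀ : ℕ) :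
    ∃ e : ℕ, e₀ ≤ e ∧ 3 ≤ e ∧ ∃ (a : (ZMod (2 ^ e))ˣ) (D : ℕ) (t : (ZMod (2 ^ e))ˣ → ℤ), 0 < D ∧
      (∀ b : (ZMod (2 ^ e))ˣ, (t b : ℚ) = D * ratMinusSymbol f ((((a * b : (ZMod (2 ^ e))ˣ) : ZMod (2 ^ e)).val : ℚ) / 2 ^ e)) ∧
      ∃ (c d : ℕ) (uc ud : ℤ_[2]ˣ) (cb db : (ZMod (2 ^ e))ˣ),
        (uc : ℤ_[2]) = c ∧ (ud : ℤ_[2]) = d ∧ (cb : ZMod (2 ^ e)) = c ∧ (db : ZMod (2 ^ e)) = d ∧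
        Nat.Coprime c (2 * Qc) ∧ Nat.Coprime d (2 * Qd) ∧
        PowerSeries.C ((c ^ 2 * d ^ 2 * t 1 : ℤ) : ℤ_[2])
            - PowerSeries.C ((c * d ^ 2 * t cb : ℤ) : ℤ_[2]) * PowerSeries.binomialSeries ℤ_[2] (η * ell 2 uc)
            - PowerSeries.C ((c ^ 2 * d * t db⁻¹ : ℤ) : ℤ_[2]) * PowerSeries.binomialSeries ℤ_[2] (η * ell 2 ud)
            + PowerSeries.C ((c * d * t (cb * db⁻¹) : ℤ) : ℤ_[2]) * PowerSeries.binomialSeries ℤ_[2] (η * ell 2 uc) *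
                PowerSeries.binomialSeries ℤ_[2] (η * ell 2 ud) ∉ 𝔭.asIdeal := by
  classical
  obtain ⟨e, hee, he3, ψ, hψ, hψne⟩ :=
    OddTwistSupply.exists_three_unitHom_sum_ratMinusSymbol_ne_zero hR hf hQf h2N e₀
  haveI : NeZero (2 ^ e) := ⟨pow_ne_zero _ two_ne_zero⟩
  -- the untranslated symbol function and a non-vanishing cusp `a`
  set s₁ : (ZMod (2 ^ e))ˣ → ℚ := fun b ↦ ratMinusSymbol f (((b : ZMod (2 ^ e)).val : ℚ) / 2 ^ e) with hs₁
  have hψne' : ∀ i, ∑ b : (ZMod (2 ^ e))ˣ, ψ i b * ((s₁ b : ℚ) : ℂ) ≠ 0 := fun i ↦ by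
    simpa only [hs₁] using hψne i
  obtain ⟨a, ha⟩ : ∃ a : (ZMod (2 ^ e))ˣ, s₁ a ≠ 0 := by
    by_contra h
    push Not at h
    exact hψne' 0 (Finset.sum_eq_zero fun b _ ↦ by rw [h b, Rat.cast_zero, mul_zero])
  -- translate by `a` and clear denominators
  set s : (ZMod (2 ^ e))ˣ → ℚ := fun b ↦ s₁ (a * b) with hs
  obtain ⟨D, t, hD, ht⟩ := exists_int_eq_mul s
  have ht1 : t 1 ≠ 0 := by
    intro h0
    have := ht 1
    rw [h0, Int.cast_zero, hs] at this
    simp only [mul_one] at this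
    exact mul_ne_zero (by exact_mod_cast hD.ne') ha this.symm
  have hval : ∀ i x, ψ i x ≠ 0 := fun i x hx ↦ by
    have := map_mul (ψ i) x x⁻¹
    rw [mul_inv_cancel, map_one, hx, zero_mul] at this
    exact one_ne_zero this
  have htne : ∀ i, ∑ b : (ZMod (2 ^ e))ˣ, ψ i b * (t b : ℂ) ≠ 0 := by
    intro i h0
    apply hψne' i
    -- `∑ ψ(b) t(b) = D · ψ(a)⁻¹ · ∑ ψ(b') s₁(b')`
    have hre : ∑ b : (ZMod (2 ^ e))ˣ, ψ i b * (t b : ℂ) =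
        (D : ℂ) * (ψ i a)⁻¹ * ∑ b : (ZMod (2 ^ e))ˣ, ψ i b * ((s₁ b : ℚ) : ℂ) := by
      rw [Finset.mul_sum]
      refine (Fintype.sum_equiv (Equiv.mulLeft a) _ _ fun b ↦ ?_)
      simp only [Equiv.coe_mulLeft, map_mul]
      have htb : (t b : ℂ) = (D : ℂ) * ((s₁ (a * b) : ℚ) : ℂ) := by
        have h := congrArg (fun q : ℚ ↦ (q : ℂ)) (ht b)
        simp only [hs, Rat.cast_intCast, Rat.cast_mul, Rat.cast_natCast] at h
        exact h
      rw [htb]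
      have hinv : (ψ i a)⁻¹ * ψ i a = 1 := inv_mul_cancel₀ (hval i a)
      linear_combination (-((D : ℂ) * ψ i b * ((s₁ (a * b) : ℚ) : ℂ))) * hinv
    rw [hre] at h0
    rcases mul_eq_zero.mp h0 with h1 | h1
    · rcases mul_eq_zero.mp h1 with h2' | h2'
      · exact absurd h2' (by exact_mod_cast hD.ne')
      · exact absurd h2' (inv_ne_zero (hval i a))
    · exact h1
  obtain ⟨c, d, uc, ud, cb, db, h1, h2', h3, h4, h5, h6, hmem⟩ :=
    exists_cuspElement_not_mem he3 t ht1 ψ hψ htne hQc2 hQc5 hQd η 𝔭 h𝔭 h2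
  refine ⟨e, hee, he3, a, D, t, hD, fun b ↦ by rw [ht b], c, d, uc, ud, cb, db, h1, h2', h3, h4, h5, h6, hmem⟩

end Summit.BirchSwinnertonDyer.BirchSwinnertonDyer.Theorems.SignedKatoOffTwo.CuspEval

end
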